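import Summits.NavierStokesRegularity.FluidComputer.GateBudgetClockBand
import HarnessLib

/-!
# GateBudget part 77 — cold damping of the transfer mode (§228–§230)

Cell `pub-fluidc`, blueprint seat bp1 (gen 36, fourth item: the first file of THE d-LEDGER,
SPEC-INPUT-bp1 §BJ); namespace `Summit.NavierStokesRegularity.FluidComputer.GateBudget`,
two-scale family `RotorKnob.rotorCircuit K M ε ρ` from `delayInit` (§228 holds for every
member with `K ≥ 0`; §229 for the headline member `M = K¹⁰`, `K ≥ 16`).
HONEST FRAMING: a low prior, high value-of-information experiment on Tao's machine paradigm;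
NOT a claim that NS blows up.

WHAT. The transfer mode obeys the LINEAR equation `d' = ρ⁻²ca - Kãd` ((d-eq) of (5.5)): a
forcing `ρ⁻²ca` of size at most `ρ⁻²c` (`|a| ≤ 1`, `c ≥ 0`) and a damping at rate `Kã ≥ 0`,
non-decreasing in time (`ã' = Kd²`). §228 `cold_damping` is the variation-of-constants bound:
if `c ≤ c₁` and `A ≤ ã` on `[T, t]` (`T ≥ 0`) then
  `|d(t)| ≤ |d(T)|·e^{-KA(t - T)} + (c₁/ρ²)(t - T)`
(integrating exponent `P(s) = ∫_T^s Kã`, non-decreasing and `≥ KA(s - T)`; the conjugated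
mode `G = d·e^{P}` has `|G'| = ρ⁻²c|a|e^{P} ≤ (c₁/ρ²)e^{P(t)}` on `[T, t]`). §229 reads it on
a COLD PHASE of the headline member — from a dousing `T` (pulse exit) to the next relight
`r`, where part 60 §186 supplies `c ≤ ρ²/K⁹` on `[T, r]` and `r ≤ T + 3` (hypotheses here):
  `knob_cold_transfer`:  `|d(r)| ≤ |d(T)|·e^{-Kã(T)(r - T)} + 3/K⁹`,
and with clock levels `b(T) ≤ -θ'ε`, `b(r) ≥ θnε`, `θ' ≥ 1`, `θn ≥ 5/4` the cold phase
lasts `r - T ≥ θn + θ' ≥ 9/4` (part 73 §220: the clock charges at rate at most `ε`), so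
  `knob_cold_transfer_levels`:  `|d(r)| ≤ |d(T)|·e^{-(9/4)Kã(T)} + 3/K⁹`.
§230 `damping_beats_drift` is the real inequality that closes the recursion of §BJ:
`e^{-(9/4)x}(1 + y) ≤ e^{-2x}` for `y ≤ x/4`; per rung (`x = Kã(T')`, `y = 242x/K⁹`,
`242/K⁹ ≤ 1/4`) the cold damping AFTER a pulse beats the co-rotating drift amplification
`1 + 242Kã(T')/K⁹` OF that pulse, termwise and with no condition on `ã(T')`
(`damping_beats_drift_rung`).

WHY (the d-ledger, SPEC-INPUT-bp1 §BJ). Part 76 §227's per-rung ceiling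
`Δã ≤ (7/2 + k²/3 + (2 log k + 520 log K)·d(r)²)/K⁹` carries its only `log K` on `d(r)²`,
and the ladder (parts 63–69) knows only `d(r)² ≤ 1/50`. Along the clean ladder
`r₀ < T'₀ < r₁ < T'₁ < …` the present file is the COLD half of the recursion
`d_{n+1} ≤ e^{-2Kã(T'_n)}·d_n + ι_n` (`d_n = |d(r_n)|`); the PULSE half (a phase-resolved
form of part 14 §43's co-rotating drift: `|d(T')| ≤ (1 + 242Kã(T')/K⁹)|d(r)| + δ₀ +
4kã(T')/K⁹ + 10⁻⁶/K⁹`) and the ledger along the ladder are the next parts. Aimed at, not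
proved here: `d_n = O(1/K)` always and `O(K⁻⁹)` once `Kã ≥ 1`, hence a log-free per-rung
ceiling and a two-sided `Θ(K⁹)` clean dud horizon (θ-limited constant).

HONEST LIMITS. (i) §228/§229 bound `|d|` from above only — no sign, nothing about `a`;
(ii) the forced response `(c₁/ρ²)(t - T)` ignores its own damping (the sharper
`min(t - T, 1/(KA))` is not needed by §BJ); (iii) the cold-phase trigger bound `c ≤ ρ²/K⁹`,
the duration `r ≤ T + 3` and the clock levels are HYPOTHESES here (conclusions of part 60
§186 and of the rung theorems at their data); (iv) nothing about the pulse, the dose phase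
or the output budget; (v) nothing about Navier–Stokes.
[cite: Tao2016AveragedNS, §5.5 Theorem 5.3, (5.5), (d-eq), (ta-eq), (b-eq), (est)]
-/

noncomputable section

namespace Summit.NavierStokesRegularity.FluidComputer.GateBudget

open Real Set Filter Topology
open Literature.Analysis.FluidPDE.Tao2016AveragedNS

variable {K M ε ρ : ℝ} {X : ℝ → Fin 5 → ℝ}

/-! ## §228 Variation of constants for the transfer mode -/

/-- §228 **COLD DAMPING** (any member from `delayInit`, `K ≥ 0`, `T ≥ 0`): if `c ≤ c₁` and
`A ≤ ã` on `[T, t]` then `|d(t)| ≤ |d(T)|e^{-KA(t - T)} + (c₁/ρ²)(t - T)`. (`d' = ρ⁻²ca - Kãd`;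
conjugate by `e^{P}`, `P(s) = ∫_T^s Kã ≥ KA(s - T)` non-decreasing; `|(de^{P})'| = ρ⁻²c|a|e^{P}
≤ (c₁/ρ²)e^{P(t)}` on `[T, t]`.) [cite: Tao2016AveragedNS, §5.5 (d-eq), (ta-eq), (est)] -/
theorem cold_damping (hX : ∀ t, HasDerivAt X (RotorKnob.rotorCircuit K M ε ρ (X t)) t)
    (h0 : X 0 = delayInit) (hK : 0 ≤ K) {T t c₁ A : ℝ} (hT : 0 ≤ T) (hTt : T ≤ t)
    (hc : ∀ s ∈ Icc T t, X s 2 ≤ c₁) (hA : ∀ s ∈ Icc T t, A ≤ X s 4) :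
    |X t 3| ≤ |X T 3| * exp (-(K * A * (t - T))) + c₁ / ρ ^ 2 * (t - T) := by
  have hTI : T ∈ Icc T t := left_mem_Icc.2 hTt
  have htI : t ∈ Icc T t := right_mem_Icc.2 hTt
  have hc1 : 0 ≤ c₁ := (RotorKnob.c_nonneg hX h0 hT).trans (hc T hTI)
  have hρ2 : 0 ≤ (ρ ^ 2)⁻¹ := inv_nonneg.2 (sq_nonneg ρ)
  -- the integrating exponent `P(s) = ∫_T^s Kã`
  set P : ℝ → ℝ := fun s => ∫ u in T..s, K * X u 4 with hP_def
  have hP : ∀ s, HasDerivAt P (K * X s 4) s := fun s =>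
    ((continuous_const.mul (RotorKnob.continuous_traj hX 4)).integral_hasStrictDerivAt
      T s).hasDerivAt
  have hP0 : P T = 0 := by simp [hP_def]
  -- `P` is non-decreasing on `[T, t]`, and `P(s) ≥ KA(s - T)` there
  have hPmono := Thm53.monotoneOn_sub_of_le_deriv (f := P) (f' := fun s => K * X s 4)
    (Φ := fun _ => (0 : ℝ)) (φ := fun _ => (0 : ℝ)) (convex_Icc T t) (fun s _ => hP s)
    (fun s _ => hasDerivAt_const s (0 : ℝ))
    (fun s hs => mul_nonneg hK (RotorKnob.e_nonneg hX h0 hK (hT.trans hs.1)))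
  have hPlow := Thm53.monotoneOn_sub_of_le_deriv (f := P) (f' := fun s => K * X s 4)
    (Φ := fun s => K * A * s) (φ := fun _ => K * A) (convex_Icc T t) (fun s _ => hP s)
    (fun s _ => by simpa using (hasDerivAt_id' s).const_mul (K * A))
    (fun s hs => mul_le_mul_of_nonneg_left (hA s hs) hK)
  have hPt : K * A * (t - T) ≤ P t := by
    have h := hPlow hTI htI hTt
    simp only [hP0] at h
    linarith
  have hPle : ∀ s ∈ Icc T t, P s ≤ P t := fun s hs => by
    have h := hPmono hs htI hs.2
    simpa using h
  -- the conjugated mode `G = d·e^{P}`: `G' = ρ⁻²ca·e^{P}`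
  set G : ℝ → ℝ := fun s => X s 3 * exp (P s) with hG_def
  have hG : ∀ s, HasDerivAt G ((ρ ^ 2)⁻¹ * X s 2 * X s 0 * exp (P s)) s := fun s => by
    refine ((RotorKnob.hasDerivAt_d hX s).mul (hP s).exp).congr_deriv ?_
    ring
  set Cb : ℝ := (ρ ^ 2)⁻¹ * c₁ * exp (P t) with hCb_def
  have hbd : ∀ s ∈ Icc T t, |(ρ ^ 2)⁻¹ * X s 2 * X s 0 * exp (P s)| ≤ Cb := by
    intro s hs
    have hc0 : 0 ≤ X s 2 := RotorKnob.c_nonneg hX h0 (hT.trans hs.1)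
    have ha : |X s 0| ≤ 1 := RotorKnob.traj_abs_le_one hX h0 s 0
    have hee : exp (P s) ≤ exp (P t) := exp_le_exp.2 (hPle s hs)
    rw [abs_mul, abs_mul, abs_mul, abs_of_nonneg hρ2, abs_of_nonneg hc0,
      abs_of_pos (exp_pos (P s))]
    have h1 : (ρ ^ 2)⁻¹ * X s 2 ≤ (ρ ^ 2)⁻¹ * c₁ := mul_le_mul_of_nonneg_left (hc s hs) hρ2
    have h2 : (ρ ^ 2)⁻¹ * X s 2 * |X s 0| ≤ (ρ ^ 2)⁻¹ * c₁ * 1 :=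
      mul_le_mul h1 ha (abs_nonneg _) (mul_nonneg hρ2 hc1)
    have h3 := mul_le_mul h2 hee (exp_pos _).le (by rw [mul_one]; exact mul_nonneg hρ2 hc1)
    simpa [hCb_def] using h3
  have hanti := Thm53.antitoneOn_sub_of_deriv_le (f := G)
    (f' := fun s => (ρ ^ 2)⁻¹ * X s 2 * X s 0 * exp (P s)) (Φ := fun s => Cb * s)
    (φ := fun _ => Cb) (convex_Icc T t) (fun s _ => hG s)
    (fun s _ => by simpa using (hasDerivAt_id' s).const_mul Cb)
    (fun s hs => (abs_le.1 (hbd s hs)).2)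
  have hmono := Thm53.monotoneOn_sub_of_le_deriv (f := G)
    (f' := fun s => (ρ ^ 2)⁻¹ * X s 2 * X s 0 * exp (P s)) (Φ := fun s => -Cb * s)
    (φ := fun _ => -Cb) (convex_Icc T t) (fun s _ => hG s)
    (fun s _ => by simpa using (hasDerivAt_id' s).const_mul (-Cb))
    (fun s hs => (abs_le.1 (hbd s hs)).1)
  have hGT : G T = X T 3 := by simp [hG_def, hP0]
  have hup : G t ≤ X T 3 + Cb * (t - T) := by
    have h := hanti hTI htI hTt
    simp only [hGT] at h
    linarith
  have hlo : X T 3 - Cb * (t - T) ≤ G t := by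
    have h := hmono hTI htI hTt
    simp only [hGT] at h
    linarith
  have hGabs : |X t 3| * exp (P t) ≤ |X T 3| + Cb * (t - T) := by
    have e : |X t 3| * exp (P t) = |G t| := by
      simp only [hG_def, abs_mul, abs_of_pos (exp_pos (P t))]
    rw [e]
    exact abs_le.2 ⟨by linarith [neg_abs_le (X T 3)], by linarith [le_abs_self (X T 3)]⟩
  -- undo the conjugation
  have e1 : exp (P t) * exp (-P t) = 1 := by rw [← exp_add, add_neg_cancel, exp_zero]
  have hexp : exp (-P t) ≤ exp (-(K * A * (t - T))) := exp_le_exp.2 (by linarith)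
  have hlast := mul_le_mul_of_nonneg_left hexp (abs_nonneg (X T 3))
  calc |X t 3| = |X t 3| * exp (P t) * exp (-P t) := by rw [mul_assoc, e1, mul_one]
    _ ≤ (|X T 3| + Cb * (t - T)) * exp (-P t) :=
        mul_le_mul_of_nonneg_right hGabs (exp_pos _).le
    _ = |X T 3| * exp (-P t) + c₁ / ρ ^ 2 * (t - T) * (exp (P t) * exp (-P t)) := by
        rw [hCb_def]; ring
    _ = |X T 3| * exp (-P t) + c₁ / ρ ^ 2 * (t - T) := by rw [e1, mul_one]
    _ ≤ |X T 3| * exp (-(K * A * (t - T))) + c₁ / ρ ^ 2 * (t - T) := by linarith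

/-! ## §229 The cold phase damps the transfer mode -/

/-- §229 **COLD TRANSFER** (headline member, `K ≥ 16`): on a cold phase `[T, r]` (`T ≥ 0`,
`r ≤ T + 3`, `c ≤ ρ²/K⁹` on it — part 60 §186) `|d(r)| ≤ |d(T)|e^{-Kã(T)(r - T)} + 3/K⁹`
(`ã ≥ ã(T)` on `[T, r]`: the output is non-decreasing). [derived: this file §229] -/
theorem knob_cold_transfer
    (hX : ∀ t, HasDerivAt X (RotorKnob.rotorCircuit K (K ^ 10) ε ρ (X t)) t)
    (h0 : X 0 = delayInit) (hK : 16 ≤ K) {T r : ℝ} (hT : 0 ≤ T) (hTr : T ≤ r)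
    (hr3 : r ≤ T + 3) (hc : ∀ t ∈ Icc T r, X t 2 ≤ ρ ^ 2 / K ^ 9) (hρ : 0 < ρ) :
    |X r 3| ≤ |X T 3| * exp (-(K * X T 4 * (r - T))) + 3 / K ^ 9 := by
  have hK0 : (0 : ℝ) ≤ K := by linarith
  have hK9 : (0 : ℝ) < K ^ 9 := by positivity
  have hmono := RotorKnob.rotorCircuit_output_monotone hK0 hX
  have h := cold_damping hX h0 hK0 hT hTr hc (fun s hs => hmono hs.1)
  have e : ρ ^ 2 / K ^ 9 / ρ ^ 2 = (K ^ 9)⁻¹ := by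
    rw [div_right_comm, div_self (pow_ne_zero 2 hρ.ne'), one_div]
  rw [e] at h
  have h3 : (K ^ 9)⁻¹ * (r - T) ≤ (K ^ 9)⁻¹ * 3 :=
    mul_le_mul_of_nonneg_left (by linarith) (inv_nonneg.2 hK9.le)
  rw [div_eq_inv_mul (3 : ℝ)]
  linarith

/-- §229 **COLD TRANSFER BETWEEN CLOCK LEVELS** (headline member, `K ≥ 16`, `ε > 0`): if
moreover `b(T) ≤ -θ'ε` and `b(r) ≥ θnε` with `θ' ≥ 1`, `θn ≥ 5/4` (a dousing at level `θ'`
followed by an ignition at level `θn`), then `r - T ≥ 9/4` (the clock charges at rate `≤ ε`,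
part 73 §220) and `|d(r)| ≤ |d(T)|e^{-(9/4)Kã(T)} + 3/K⁹`. [derived: this file §229] -/
theorem knob_cold_transfer_levels
    (hX : ∀ t, HasDerivAt X (RotorKnob.rotorCircuit K (K ^ 10) ε ρ (X t)) t)
    (h0 : X 0 = delayInit) (hK : 16 ≤ K) (hε : 0 < ε) {T r θ' θn : ℝ} (hT : 0 ≤ T)
    (hTr : T ≤ r) (hr3 : r ≤ T + 3) (hc : ∀ t ∈ Icc T r, X t 2 ≤ ρ ^ 2 / K ^ 9) (hρ : 0 < ρ)
    (hbT : X T 1 ≤ -(θ' * ε)) (hbr : θn * ε ≤ X r 1) (hθ' : 1 ≤ θ') (hθ : 5 / 4 ≤ θn) :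
    9 / 4 ≤ r - T ∧ |X r 3| ≤ |X T 3| * exp (-(9 / 4 * (K * X T 4))) + 3 / K ^ 9 := by
  have hK0 : (0 : ℝ) ≤ K := by linarith
  have hM : (0 : ℝ) ≤ K ^ 10 := by positivity
  have hch := clock_charge_le hX h0 hε.le hM hTr
  have hdur : 9 / 4 ≤ r - T := by
    have p1 := mul_nonneg (sub_nonneg.2 hθ) hε.le
    have p2 := mul_nonneg (sub_nonneg.2 hθ') hε.le
    have h2 : ε * (9 / 4) ≤ ε * (r - T) := by nlinarith [hch, hbT, hbr, p1, p2]
    exact le_of_mul_le_mul_left h2 hε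
  have h := knob_cold_transfer hX h0 hK hT hTr hr3 hc hρ
  have hKe : 0 ≤ K * X T 4 := mul_nonneg hK0 (RotorKnob.e_nonneg hX h0 hK0 hT)
  have hexp : exp (-(K * X T 4 * (r - T))) ≤ exp (-(9 / 4 * (K * X T 4))) :=
    exp_le_exp.2 (by nlinarith [hKe, hdur])
  have := mul_le_mul_of_nonneg_left hexp (abs_nonneg (X T 3))
  exact ⟨hdur, by linarith⟩

/-! ## §230 The damping after a pulse beats the drift of the pulse -/

/-- §230 `e^{-(9/4)x}(1 + y) ≤ e^{-2x}` for `y ≤ x/4` (`1 + y ≤ e^{y} ≤ e^{x/4}`). [folklore] -/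
theorem damping_beats_drift {x y : ℝ} (hyx : y ≤ x / 4) :
    exp (-(9 / 4 * x)) * (1 + y) ≤ exp (-(2 * x)) := by
  have h1 : 1 + y ≤ exp y := by linarith [add_one_le_exp y]
  have h2 : exp y ≤ exp (x / 4) := exp_le_exp.2 hyx
  calc exp (-(9 / 4 * x)) * (1 + y) ≤ exp (-(9 / 4 * x)) * exp (x / 4) :=
        mul_le_mul_of_nonneg_left (h1.trans h2) (exp_pos _).le
    _ = exp (-(2 * x)) := by rw [← exp_add]; congr 1; ring

/-- §230 **PER RUNG** (`K ≥ 16`, `x ≥ 0`): `e^{-(9/4)x}(1 + 242x/K⁹) ≤ e^{-2x}` — with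
`x = Kã(T')`, the cold damping `e^{-(9/4)Kã(T')}` after a pulse (§229) times the drift
amplification `1 + 242Kã(T')/K⁹` of that pulse (SPEC-INPUT-bp1 §BJ (D0)) is at most `e^{-2Kã(T')}`,
for EVERY value of `ã(T')`. [derived: this file §230] -/
theorem damping_beats_drift_rung (hK : 16 ≤ K) {x : ℝ} (hx : 0 ≤ x) :
    exp (-(9 / 4 * x)) * (1 + 242 * x / K ^ 9) ≤ exp (-(2 * x)) := by
  have hK9 : (16 : ℝ) ^ 9 ≤ K ^ 9 := pow_le_pow_left₀ (by norm_num) hK 9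
  have hK9' : (0 : ℝ) < K ^ 9 := lt_of_lt_of_le (by norm_num) hK9
  refine damping_beats_drift ?_
  rw [div_le_div_iff₀ hK9' (by norm_num : (0 : ℝ) < 4)]
  nlinarith [hK9, hx]

end Summit.NavierStokesRegularity.FluidComputer.GateBudget
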